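import Summits.QuantumFields.YangMills.Theorems.BalabanUVNodesPortS1JacDomLocalDet
import Summits.QuantumFields.YangMills.Theorems.BalabanUVNodesPortS1JacKStepDefs
import Summits.QuantumFields.YangMills.Theorems.BalabanUVNodesPortS1JacCoverDeriv
import Summits.QuantumFields.YangMills.Theorems.BalabanUVNodesPortS1JacIntLocal
import Summits.QuantumFields.YangMills.Theorems.BalabanUVNodesPortS1JacTorusRows

/-!
# NODE O port PT-A — `stub_LZjacDom`, PART 2: THE TOWER ASSEMBLY — ★★★ `jacRowsABDom_holds : JacRowsABDom F`: rows (a)(b) of the torus Jacobian functional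
# `J_T(c, 𝐔) = jacFactorCt c (iterMh k 𝐔)` at every tower-loop-small `SL(2,ℂ)` field, with `a := 1∕(5168·576·L⁴)` and `E := 2`, uniformly in the volume `K`, the step `k` and the bond `c`

Cell `ym-nodeO-ideate`, porter seat `ymgap-nodeO-port-PTA-1` (gen 7, lead of the line `pta-residueW` of 27930's skeleton); `--supports stmt-QuantumFields-27930` (helper).
[I] = [Balaban1987RG1], [15] = [Balaban1985Variational], [III] = [Balaban1988Convergent].

WHY.  `JacRowsABDom F` (✓ `…JacKStepDefs`) reads the hypothesis `TowerLoopSmall k c a φ.1` ON THE TOWER REGION `Y(c) := B^{k+1} ⁻¹' {c₋, c₊}` ONLY: `det φ.1 = 1` at the fine bonds of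
`Y(c)` and loop matrices of `Ū^j(φ.1)`, `j ≤ k`, within `a` of `1` at the region's coarse bonds.  PART 1 (✓∕companion `…JacDomLocal`, `…JacDomLocalDet`) localized PTZ-1's ONE-STEP rows to
the component block under the polydisc condition AT `c` (the determinant hypothesis global).  THIS FILE assembles the tower:
(§1) the flat field: `holMh 1 = 1`, `avgMh 1 = 1`, `iterMh k 1 = 1` (so `J_T(c, 1) = jacFactorCt c 1`);
(§2) DET-ONE PROPAGATES UP THE TOWER REGION — `det (Ū^j(𝐕))(b) = 1` at every `b ∈ bondsIn j Y(c)`, `j ≤ k` (induction: the average at a region bond reads the region only —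
dag-n12-c's `avgMh_apply_congr_of_eqOn_bondsIn` on the SATURATED region `preimage_blockIter_saturated` — so it is the average of the SPLICE «iterate on `bondsIn j Y`, `1` elsewhere», a
globally det-one field whose loops at the bond are the iterate's (`loopMh_splice_eq`), and PTZ-1's `det_avgMh_eq_one` applies);
(§3) `W`-LEVEL LOCALITY OF THE JACOBIAN FACTOR — `jacFactorCt c W = jacFactorCt c W'` whenever `W, W'` agree on `bondsIn k Y(c)` (gen 6's cover bridge `jacFactorCt_coverBondAt` + integer
window locality `jacFactorZ_congr_of_eqOn_winBondsZ`; the covered window bonds lie in `bondsIn k Y(c)` by `Node00.blockOf_coverAt`);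
(§4) the uniform constants: `|Idx (F.P K)| = 576·L⁴` for every `K`, so `r(c) = N_c∕|I| ≥ 1∕(576 L⁴)` and `a := 1∕(5168·576·L⁴)` satisfies PTZ-1's `646·a ≤ r∕8`, `a ≤ 1∕24`;
(§5) ★★★ `jacRowsABDom_holds`: at a tower-loop-small `φ`, `J_T(c, 𝐕) = jacFactorCt c (S 𝐕)` for EVERY `𝐕`, `S 𝐕 :=` the splice of `Ū^k(𝐕)` on `bondsIn k Y(c)` with `1` (§3); `S` is
analytic at `φ.1` (componentwise dag-n12-c's ★★ `analyticAt_iterMh_apply_of_polydiscOn` on the saturated region, constants elsewhere); `S φ.1` is globally det-one (§2) with loops at `c`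
within `a` (splice); so PART 1's rows give analyticity of `𝐕 ↦ J_T(c, 𝐕)` at `φ.1` (composition, then with the first projection of the pair) and `|J_T(c, φ.1) − log r³| ≤ 1`,
`|J_T(c, 1) − log r³| ≤ 1` (§1), whence `E = 2`.
CONSUMED BY NAME: PART 1; ✓ `…JacKStepDefs` (`TowerLoopSmall`, `JacRowsABDom`); ✓p814414 `…JacCoverDeriv` (`jacFactorCt_coverBondAt`), ✓p814297 `…JacCover` (`jacFactorZ_congr_of_eqOn_winBondsZ`,
`mem_winBondsZ_iff`), ✓p814447 `…JacIntLocal` (`blockMap_of_mem_winSitesZ`), ✓p815553 `…JacTorusRows` (`coverBondAt_valLift`, `coverBondAt_tgt`); dag-n12-c's `B15AveragingHolomorphicTowerRegion`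
(`preimage_blockIter_saturated`, `self_mem_bondsIn_towerRegion`, `blockIter_toFine`), `…LocalAnalytic` (`analyticAt_iterMh_apply_of_polydiscOn`, `loopMh_splice_eq`), `…Local`
(`avgMh_apply_congr_of_eqOn_bondsIn`); PTZ-1's ✓p812756 `det_avgMh_eq_one`; `Node00.blockOf_coverAt`.

HONEST FRAMING.  Lattice ∕ calculus bookkeeping over the tree's own holomorphic (0.4) model and the landed one-step rows; NOTHING of Bałaban's renormalization-group estimates asserted, ported or
discharged; this closes the registered stub `stub_LZjacDom` in substance (the by-name stub file is PART 3); `stub_LZdet` BLOCKED-ON P0 (α)+(β), `stub_FE` XXL; 27930 ⁸-Ax-LR4 OPEN · no claim;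
K0⁷∕K-Ax OPEN; NODE O 0∕1; COUNT 8∕28 · K 1∕4 UNMOVED; finite `𝕋⁴_{L^K}` at fixed ε — NOT continuum ∕ OS ∕ Clay; **the Yang–Mills mass gap is NOT proved by any of this.**  No `sorry`,
no `def`, no `instance`, no `notation`; standard axioms.
-/

noncomputable section

open scoped BigOperators Matrix.Norms.L2Operator Topology

namespace Summit.QuantumFields.YangMills.Theorems.BalabanUVNodesPortS1

open Summit.QuantumFields.YangMills.Theorems.K0RecordFormatNames
open Literature.MathematicalPhysics.QuantumFieldTheory.Balaban1983to89
open Literature.MathematicalPhysics.QuantumFieldTheory.Balaban1983to89.Node00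
open Literature.MathematicalPhysics.QuantumFieldTheory.Balaban1983to89.T4Continuum (T4Family LStep)
open Literature.MathematicalPhysics.QuantumFieldTheory.Balaban1983to89.BlockAveraging (Idx)
open Literature.MathematicalPhysics.QuantumFieldTheory.Balaban1983to89.BlockAveragingHaarAC (IsCentral nCentral nCentral_pos)
open Literature.MathematicalPhysics.QuantumFieldTheory.Balaban1983to89.ExpMeanLog (eml eml_eq_exp)
open Literature.MathematicalPhysics.QuantumFieldTheory.Balaban1983to89.MatrixLog (mlog mlog_one)
open Literature.MathematicalPhysics.QuantumFieldTheory.Balaban1983to89.B15AveragingHolomorphic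
open Literature.MathematicalPhysics.QuantumFieldTheory.Balaban1983to89.B15AveragingHolomorphicLocal (avgMh_apply_congr_of_eqOn_bondsIn)
open Literature.MathematicalPhysics.QuantumFieldTheory.Balaban1983to89.B15AveragingHolomorphicLocalAnalytic (analyticAt_iterMh_apply_of_polydiscOn loopMh_splice_eq)
open Literature.MathematicalPhysics.QuantumFieldTheory.Balaban1983to89.B15AveragingHolomorphicTowerRegion
  (preimage_blockIter_saturated self_mem_bondsIn_towerRegion)
open Literature.MathematicalPhysics.QuantumFieldTheory.Balaban1983to89.B10Eq42TorusConstraint (bondsIn mem_bondsIn_iff)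
open Literature.MathematicalPhysics.QuantumFieldTheory.Balaban1983to89.B10Eq38TorusDomains (toFine)
open Literature.MathematicalPhysics.QuantumFieldTheory.Balaban1983to89.B7Prop1Explicit (e)
open Literature.MathematicalPhysics.QuantumLattice (blockMap)
open _root_.Matrix _root_.Filter

variable {P : Params}

/-! ## §1  The flat field through the holomorphic model: `holMh 1 = 1`, `avgMh 1 = 1`, `iterMh k 1 = 1` -/

section Flat

variable {j : ℕ}

/-- Walk products of the flat field are `1`. [cite: Balaban1987RG1, (0.4) p.253 (bookkeeping)] -/
theorem holMh_one : ∀ γ : List (LStep P j), holMh (1 : PBond P j → MatA 2) γ = 1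
  | [] => holMh_nil _
  | s :: γ => by
    rw [holMh_cons, holMh_one γ, mul_one]
    unfold stepMh
    split_ifs
    · rfl
    · rw [Pi.one_apply, Matrix.adjugate_one]

/-- The (0.4) loop matrices of the flat field are `1`. [cite: Balaban1987RG1, (0.4) p.253 (bookkeeping)] -/
theorem loopMh_one (c : PBond P (j + 1)) (i : Idx P) : loopMh (1 : PBond P j → MatA 2) c i = 1 := holMh_one _

/-- `eml` of the constant family `1` is `1` (`log 1 = 0`, `exp 0 = 1`). [folklore] -/
theorem eml_const_one {ι : Type*} [Fintype ι] : eml (fun _ : ι => (1 : MatA 2)) = 1 := by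
  rw [eml_eq_exp]
  simp only [mlog_one, Finset.sum_const_zero, smul_zero, NormedSpace.exp_zero]

/-- The holomorphic (0.4) average of the flat field is flat. [cite: Balaban1987RG1, (0.4) p.253 (bookkeeping)] -/
theorem avgMh_one : avgMh (1 : PBond P j → MatA 2) = 1 := by
  funext c
  show corrMh (1 : PBond P j → MatA 2) c * axialMh (1 : PBond P j → MatA 2) c = 1
  unfold corrMh axialMh
  rw [show (fun i : Idx P => loopMh (1 : PBond P j → MatA 2) c i) = fun _ => 1 from funext (loopMh_one c), eml_const_one, holMh_one, mul_one]

/-- The `k`-fold holomorphic iterate of the flat field is flat. [cite: Balaban1987RG1, (0.21) p.256 (bookkeeping)] -/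
theorem iterMh_one : ∀ k : ℕ, iterMh k (1 : PBond P 0 → MatA 2) = 1
  | 0 => rfl
  | k + 1 => by rw [iterMh_succ, iterMh_one k, avgMh_one]

/-- `J_T(c, 1) = jacFactorCt c 1`. [cite: Balaban1987RG1, p.268 (bookkeeping)] -/
theorem jacTorus_one {k : ℕ} (c : PBond P (k + 1)) : jacTorus k c (1 : PBond P 0 → MatA 2) = jacFactorCt c 1 := by
  rw [jacTorus, iterMh_one]

end Flat

/-! ## §2  Determinant one propagates up the tower region -/

section Det

variable {k : ℕ}

/-- ★ **DET-ONE PROPAGATES UP THE TOWER REGION**: if `det 𝐕 = 1` at the fine bonds of `Y(c) = B^{k+1} ⁻¹' {c₋, c₊}` and the loop matrices of `Ū^j(𝐕)`, `j ≤ k`, at the region's coarse bonds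
lie in the `1∕3`-polydisc, then `det (Ū^j 𝐕)(b) = 1` at every `b ∈ bondsIn j Y(c)`, `j ≤ k` (the average at a region bond is the average of the globally det-one SPLICE, PTZ-1's
`det_avgMh_eq_one`). [cite: Balaban1987RG1, before (0.5) p.253 («Gᶜ-valued function»), (0.21) p.256; Balaban1988Convergent, (2.2) p.255] -/
theorem det_iterMh_eq_one_of_tower (hk : k + 1 ≤ P.m + P.K) (c : PBond P (k + 1)) {a : ℝ} (ha : a < 1 / 3)
    {V : PBond P 0 → MatA 2} (hV : TowerLoopSmall k c a V) :
    ∀ j, j ≤ k → ∀ b : PBond P j, b ∈ bondsIn j (B14.Eq22Determines.blockIter (k + 1) ⁻¹' ({c.src, c.tgt} : Set (Site P (k + 1)))) → (iterMh j V b).det = 1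
  | 0, _, b, hb => by rw [iterMh_zero]; exact hV.1 b hb
  | j + 1, hj, b, hb => by
    classical
    set Y : Set (Site P 0) := B14.Eq22Determines.blockIter (k + 1) ⁻¹' ({c.src, c.tgt} : Set (Site P (k + 1)))
    have hjk : j + 1 ≤ P.m + P.K := by omega
    have hY : ∀ s : Site P j, toFine j s ∈ Y ↔ toFine (j + 1) (blockOf s) ∈ Y :=
      preimage_blockIter_saturated hk ({c.src, c.tgt} : Set (Site P (k + 1))) j (by omega)
    have ih : ∀ b' : PBond P j, b' ∈ bondsIn j Y → (iterMh j V b').det = 1 := det_iterMh_eq_one_of_tower hk c ha hV j (by omega)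
    -- the splice: the iterate on the region, `1` elsewhere
    set W : PBond P j → MatA 2 := fun b' => if b' ∈ bondsIn j Y then iterMh j V b' else (1 : PBond P j → MatA 2) b' with hW
    have hWdet : ∀ b', (W b').det = 1 := fun b' => by
      by_cases h : b' ∈ bondsIn j Y
      · simp only [hW, h, if_true]; exact ih b' h
      · simp only [hW, h, if_false, Pi.one_apply, Matrix.det_one]
    have havg : iterMh (j + 1) V b = avgMh W b := by
      rw [iterMh_succ]
      exact avgMh_apply_congr_of_eqOn_bondsIn hjk hY (fun b' hb' => by simp only [hW, hb', if_true]) hb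
    have hloops : ∀ i : Idx P, ‖loopMh W b i - 1‖ < 1 / 3 := fun i => by
      rw [hW, loopMh_splice_eq hjk hY (iterMh j V) (1 : PBond P j → MatA 2) hb i]
      exact (hV.2 j (by omega) b hb i).trans_lt ha
    rw [havg]
    exact det_avgMh_eq_one W hWdet b hloops

end Det

/-! ## §3  `W`-level locality of the Jacobian factor on the tower region (via the cover bridge) -/

section Locality

variable {k : ℕ}

/-- A level-`k` bond whose endpoints have their `(k+1)`-blocks among `{c₋, c₊}` is a bond of the tower region `Y(c)` (saturation + `blockIter ∘ toFine = id`).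
[cite: Balaban1988Convergent, (2.2) p.255 (bookkeeping)] -/
theorem mem_bondsIn_towerRegion_of_blockOf (hk : k + 1 ≤ P.m + P.K) (c : PBond P (k + 1)) (b : PBond P k)
    (h1 : blockOf b.src = c.src ∨ blockOf b.src = c.tgt) (h2 : blockOf b.tgt = c.src ∨ blockOf b.tgt = c.tgt) :
    b ∈ bondsIn k (B14.Eq22Determines.blockIter (k + 1) ⁻¹' ({c.src, c.tgt} : Set (Site P (k + 1)))) := by
  have hY := preimage_blockIter_saturated hk ({c.src, c.tgt} : Set (Site P (k + 1))) k (Nat.lt_succ_self k)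
  have key : ∀ s : Site P k, (blockOf s = c.src ∨ blockOf s = c.tgt) → toFine k s ∈ B14.Eq22Determines.blockIter (k + 1) ⁻¹' ({c.src, c.tgt} : Set (Site P (k + 1))) := by
    intro s hs
    refine (hY s).2 ?_
    rw [Set.mem_preimage, blockIter_toFine (k + 1) hk]
    rcases hs with h | h
    · rw [h]; exact Set.mem_insert _ _
    · rw [h]; exact Set.mem_insert_of_mem _ (Set.mem_singleton _)
  rw [mem_bondsIn_iff]
  exact ⟨key _ h1, key _ h2⟩

/-- ★ **THE WINDOW-LOCAL JACOBIAN FACTOR READS THE TOWER REGION ONLY**: two level-`k` fields agreeing on `bondsIn k Y(c)` have the same `jacFactorCt c` (standing range) — gen 6's cover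
bridge `jacFactorCt_coverBondAt` and the integer window locality `jacFactorZ_congr_of_eqOn_winBondsZ`; the covered window bonds lie in the region by `Node00.blockOf_coverAt`.
[cite: Balaban1987RG1, p.267 («h(c)» reads the two blocks), (1.7) p.261, (1.21) p.264] -/
theorem jacFactorCt_congr_of_eqOn_towerRegion (hk : k + 1 ≤ P.m + P.K) (c : PBond P (k + 1)) {W W' : PBond P k → MatA 2}
    (h : ∀ b : PBond P k, b ∈ bondsIn k (B14.Eq22Determines.blockIter (k + 1) ⁻¹' ({c.src, c.tgt} : Set (Site P (k + 1)))) → W b = W' b) :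
    jacFactorCt c W = jacFactorCt c W' := by
  haveI : NeZero P.L := ⟨P.L_pos.ne'⟩
  have hL : 2 * ((P.L - 1) / 2) + 1 = P.L := AveragingRT.two_mul_half_add_one P
  set ĉ : (Fin P.d → ℤ) × Fin P.d := ((fun i => ((c.src i).val : ℤ)), c.dir)
  have hc : coverBondAt P (k + 1) ĉ = c := coverBondAt_valLift c
  have hsrc : coverAt P (k + 1) ĉ.1 = c.src := congrArg PBond.src hc
  have htgt : coverAt P (k + 1) (ĉ.1 + e ĉ.2) = c.tgt := by rw [← coverBondAt_tgt, hc]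
  rw [← hc, jacFactorCt_coverBondAt hk, jacFactorCt_coverBondAt hk]
  refine jacFactorZ_congr_of_eqOn_winBondsZ hL ĉ fun b hb => h _ ?_
  obtain ⟨hb1, hb2⟩ := mem_winBondsZ_iff.1 hb
  have hblk : ∀ z : Fin P.d → ℤ, z ∈ winSitesZ P.L ĉ → blockOf (coverAt P k z) = c.src ∨ blockOf (coverAt P k z) = c.tgt := by
    intro z hz
    rw [blockOf_coverAt hk]
    rcases blockMap_of_mem_winSitesZ hz with e1 | e1
    · left; rw [e1, hsrc]
    · right; rw [e1, htgt]
  refine mem_bondsIn_towerRegion_of_blockOf hk c _ (hblk _ hb1) ?_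
  rw [coverBondAt_tgt]
  exact hblk _ hb2

/-- ★ **`J_T(c, 𝐕)` IS THE JACOBIAN FACTOR OF THE SPLICE**: for every fine field `𝐕`, `J_T(c, 𝐕) = jacFactorCt c (b ↦ Ū^k(𝐕)(b) on bondsIn k Y(c), W₀(b) elsewhere)`, for any filler `W₀`.
[cite: Balaban1987RG1, p.267–268, (1.7) p.261] -/
theorem jacTorus_eq_jacFactorCt_splice (hk : k + 1 ≤ P.m + P.K) (c : PBond P (k + 1)) (W₀ : PBond P k → MatA 2)
    [DecidablePred (· ∈ bondsIn (P := P) k (B14.Eq22Determines.blockIter (k + 1) ⁻¹' ({c.src, c.tgt} : Set (Site P (k + 1)))))] (V : PBond P 0 → MatA 2) :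
    jacTorus k c V = jacFactorCt c (fun b => if b ∈ bondsIn k (B14.Eq22Determines.blockIter (k + 1) ⁻¹' ({c.src, c.tgt} : Set (Site P (k + 1)))) then iterMh k V b else W₀ b) := by
  rw [jacTorus]
  exact jacFactorCt_congr_of_eqOn_towerRegion hk c fun b hb => by rw [if_pos hb]

end Locality

/-! ## §4  The uniform constants of the record family: `|Idx (F.P K)| = 576·L⁴`, `r(c) ≥ 1∕(576 L⁴)` -/

section Constants

variable (F : T4Family)

/-- **The (0.4) index set of every approximation has `576·L⁴` elements** (`L⁴` offsets, `4!·4!` pairs of permutations). [cite: Balaban1987RG1, (0.4) p.253 (bookkeeping)] -/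
theorem card_idx_eq (K : ℕ) : (Fintype.card (Idx (F.P K)) : ℝ) = 576 * (F.L : ℝ) ^ 4 := by
  have h4 : Nat.factorial 4 = 24 := rfl
  have h : Fintype.card (Idx (F.P K)) = F.L ^ 4 * (24 * 24) := by
    dsimp only [BlockAveraging.Idx]
    rw [Fintype.card_prod, Fintype.card_prod, Fintype.card_fun, Fintype.card_perm, Fintype.card_fin, Fintype.card_fin, T4Family.P_d, T4Family.P_L, h4]
  rw [h]
  push_cast
  ring

/-- **The flat value `r(c) = N_c∕|I|` is at least `1∕(576 L⁴)`** at every coarse bond of every approximation (`N_c ≥ 1`). [cite: Balaban1987RG1, (0.8) p.253, p.267 (bookkeeping)] -/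
theorem inv_card_le_ratio (K : ℕ) {j : ℕ} (c : PBond (F.P K) (j + 1)) :
    1 / (576 * (F.L : ℝ) ^ 4) ≤ (nCentral c : ℝ) / (Fintype.card (Idx (F.P K)) : ℝ) := by
  rw [card_idx_eq F K]
  have hL : (1 : ℝ) ≤ F.L := by exact_mod_cast F.hL.2.le
  have hpos : (0 : ℝ) < 576 * (F.L : ℝ) ^ 4 := by positivity
  have hN : (1 : ℝ) ≤ nCentral c := by exact_mod_cast nCentral_pos c
  exact div_le_div_of_nonneg_right hN hpos.le

end Constants

/-! ## §5  ★★★ `JacRowsABDom F` -/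

/-- ★★★ **ROWS (a)(b) OF THE TORUS JACOBIAN FUNCTIONAL ON THE TOWER-LOOP-SMALL `SL(2,ℂ)` DOMAIN** — the registered stub `stub_LZjacDom` of 27930's skeleton in substance: with
`a := 1∕(5168·576·L⁴)` and `E := 2`, at every level `k + 1 ≤ m + K`, coarse bond `c` and pair `φ` with `TowerLoopSmall k c a φ.1`, the functional `ψ ↦ J_T(c, ψ.1)` is ℂ-analytic at `φ` and
`‖J_T(c, φ.1) − J_T(c, 1)‖ ≤ 2`.  Road: §3 `J_T(c, ·) = jacFactorCt c ∘ S` with `S` the splice of `Ū^k` on the tower region (analytic at `φ.1` by dag-n12-c's tower analyticity on the saturated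
region); `S φ.1` is globally det-one (§2) with loops at `c` within `a` (splice); PART 1's component rows at `S φ.1` and at `1`; `646·a ≤ r(c)∕8` by §4.
[cite: Balaban1987RG1, p.267–268 («h(c)» analytic), (1.18) p.263, (0.4) p.253; Balaban1985Variational, Prop. 9 p.309] -/
theorem jacRowsABDom_holds (F : T4Family) : JacRowsABDom F := by
  classical
  have hL1 : (1 : ℝ) ≤ F.L := by exact_mod_cast F.hL.2.le
  have hLpos : (0 : ℝ) < F.L := by linarith
  set a : ℝ := 1 / (5168 * (576 * (F.L : ℝ) ^ 4)) with ha_def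
  have ha0 : 0 < a := by rw [ha_def]; positivity
  have ha24 : a ≤ 1 / 24 := by
    rw [ha_def]
    refine one_div_le_one_div_of_le (by norm_num) ?_
    have : (1 : ℝ) ≤ (F.L : ℝ) ^ 4 := one_le_pow₀ hL1
    nlinarith
  have ha3 : a < 1 / 3 := ha24.trans_lt (by norm_num)
  refine ⟨a, 2, ha0, by norm_num, fun k K hk c φ hT => ?_⟩
  set Y : Set (Site (F.P K) 0) := B14.Eq22Determines.blockIter (k + 1) ⁻¹' ({c.src, c.tgt} : Set (Site (F.P K) (k + 1)))
  have hk' : k ≤ (F.P K).m + (F.P K).K := Nat.le_of_succ_le hk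
  have hYsat : ∀ j, j < k → ∀ s : Site (F.P K) j, toFine j s ∈ Y ↔ toFine (j + 1) (blockOf s) ∈ Y :=
    fun j hj => preimage_blockIter_saturated hk ({c.src, c.tgt} : Set (Site (F.P K) (k + 1))) j (Nat.lt_succ_of_lt hj)
  have hcY : c ∈ bondsIn (k + 1) Y := self_mem_bondsIn_towerRegion hk c
  -- the constants at `c`
  have hr := inv_card_le_ratio F K c
  have hαr : 646 * a ≤ (nCentral c : ℝ) / (Fintype.card (Idx (F.P K)) : ℝ) / 8 := by
    have e1 : 646 * a = 1 / (576 * (F.L : ℝ) ^ 4) / 8 := by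
      rw [ha_def]
      field_simp
      ring
    rw [e1]
    exact div_le_div_of_nonneg_right hr (by norm_num)
  -- the splice map and its value at `φ.1`
  set S : (PBond (F.P K) 0 → MatA 2) → (PBond (F.P K) k → MatA 2) :=
    fun V b => if b ∈ bondsIn k Y then iterMh k V b else (1 : PBond (F.P K) k → MatA 2) b with hSdef
  have hJS : ∀ V : PBond (F.P K) 0 → MatA 2, jacTorus k c V = jacFactorCt c (S V) := fun V =>
    jacTorus_eq_jacFactorCt_splice hk c 1 V
  have hdet : ∀ b, (S φ.1 b).det = 1 := fun b => by
    by_cases hb : b ∈ bondsIn k Y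
    · simp only [hSdef, hb, if_true]
      exact det_iterMh_eq_one_of_tower hk c ha3 hT k le_rfl b hb
    · simp only [hSdef, hb, if_false, Pi.one_apply, Matrix.det_one]
  have hYk : ∀ s : Site (F.P K) k, toFine k s ∈ Y ↔ toFine (k + 1) (blockOf s) ∈ Y :=
    preimage_blockIter_saturated hk ({c.src, c.tgt} : Set (Site (F.P K) (k + 1))) k (Nat.lt_succ_self k)
  have hloopS : ∀ i : Idx (F.P K), ‖loopMh (S φ.1) c i - 1‖ ≤ a := fun i => by
    have e : loopMh (S φ.1) c i = loopMh (iterMh k φ.1) c i :=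
      loopMh_splice_eq hk hYk (iterMh k φ.1) (1 : PBond (F.P K) k → MatA 2) hcY i
    rw [e]
    exact hT.2 k le_rfl c hcY i
  have hpolyS : ∀ i : Idx (F.P K), ‖loopMh (S φ.1) c i - 1‖ < 1 / 3 := fun i => (hloopS i).trans_lt ha3
  have hloopS' : ∀ i, ¬ IsCentral c i → ‖loopMh (S φ.1) c i - 1‖ ≤ a := fun i _ => hloopS i
  -- the flat field at `c`
  have hdet1 : ∀ b : PBond (F.P K) k, ((1 : PBond (F.P K) k → MatA 2) b).det = 1 := fun b => by rw [Pi.one_apply, Matrix.det_one]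
  have hpoly1 : ∀ i : Idx (F.P K), ‖loopMh (1 : PBond (F.P K) k → MatA 2) c i - 1‖ < 1 / 3 := fun i => by
    rw [loopMh_one, sub_self, norm_zero]; norm_num
  have hloop1 : ∀ i, ¬ IsCentral c i → ‖loopMh (1 : PBond (F.P K) k → MatA 2) c i - 1‖ ≤ a := fun i _ => by
    rw [loopMh_one, sub_self, norm_zero]; exact ha0.le
  refine ⟨?_, ?_⟩
  · -- row (a): analyticity
    have hSan : AnalyticAt ℂ S φ.1 := by
      refine analyticAt_pi_iff.2 fun b => ?_
      by_cases hb : b ∈ bondsIn k Y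
      · have e : (fun V : PBond (F.P K) 0 → MatA 2 => S V b) = fun V => iterMh k V b := by
          funext V; simp only [hSdef, hb, if_true]
        rw [e]
        refine analyticAt_iterMh_apply_of_polydiscOn k hk' hYsat (fun j hj c' hc' i => ?_) b hb
        exact (hT.2 j hj.le c' hc' i).trans_lt (ha3.trans (by norm_num))
      · have e : (fun V : PBond (F.P K) 0 → MatA 2 => S V b) = fun _ => 1 := by
          funext V; simp only [hSdef, hb, if_false, Pi.one_apply]
        rw [e]
        exact analyticAt_const
    have hJan : AnalyticAt ℂ (jacFactorCt c : (PBond (F.P K) k → MatA 2) → ℂ) (S φ.1) :=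
      analyticAt_jacFactorCt_of_loopSmall hk (S φ.1) hdet c hpolyS ha0.le ha24 hloopS' hαr
    have hcomp : AnalyticAt ℂ (fun V : PBond (F.P K) 0 → MatA 2 => jacTorus k c V) φ.1 := by
      have e : (fun V : PBond (F.P K) 0 → MatA 2 => jacTorus k c V) = (jacFactorCt c : (PBond (F.P K) k → MatA 2) → ℂ) ∘ S :=
        funext fun V => hJS V
      rw [e]
      exact hJan.comp hSan
    have hfst : AnalyticAt ℂ (fun p : Sect2.CPair (F.P K) (MatA 2) => p.1) φ := analyticAt_fst
    exact hcomp.comp hfst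
  · -- row (b): the uniform bound
    rw [hJS φ.1, jacTorus_one]
    have h1 := norm_jacFactorCt_sub_log_le hk (S φ.1) hdet c hpolyS ha0.le ha24 hloopS' hαr
    have h2 := norm_jacFactorCt_sub_log_le hk (1 : PBond (F.P K) k → MatA 2) hdet1 c hpoly1 ha0.le ha24 hloop1 hαr
    set ℓ : ℂ := ((Real.log (((nCentral c : ℝ) / (Fintype.card (Idx (F.P K)) : ℝ)) ^ 3) : ℝ) : ℂ)
    have e : jacFactorCt c (S φ.1) - jacFactorCt c 1 = (jacFactorCt c (S φ.1) - ℓ) - (jacFactorCt c 1 - ℓ) := by ring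
    rw [e]
    exact (norm_sub_le _ _).trans (by linarith)

end Summit.QuantumFields.YangMills.Theorems.BalabanUVNodesPortS1

end
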